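import Summits.HodgeConjecture.CorCM.Census.DihedralSexticPairCurve
import Mathlib.Algebra.BigOperators.Group.List.Basic
import Mathlib.Tactic.Linarith
import HarnessLib

/-!
# Powers `E^c × B₀^a × B₁^b` of the sextic CM threefold pair: every Galois-balanced weight, with ANY number of copies,
# is a disjoint union of lifted conjugate pairs, `k`-Weil 4-sets and pair-Weil 6-sets — the combinatorial census by
# induction (no `decide` on the configuration)

COR-CM (cell `pub-hodgecm2`), seat b30 gen 15 (2026-08-21); count-neutral; one bookkeeping definition (`ModelBalanced`),
theorems otherwise; no named fact, no geometry, no `sorry`.  Companion of `Census/DihedralSexticPairCurve.lean` (the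
14-point model `Pt'` of `Y = E × B₀ × B₁`, its `S₃ × C₂`-action `act'`, CM type `phi'` and generating weights `conjPair`,
`weil4`, `pair6`), consumed by `CorCM/DihedralSexticPairCurvePowersTransfer.lean`.

MODEL OF A POWER.  A weight of `X = ⨁_j A₃(κ j)` (`κ : Fin N → Fin 3`, any number of copies of `E`, `B₀`, `B₁`) is a
finite CONFIGURATION: a finset `T` of an arbitrary type `α` (the index set `⊔_j Hom(K_{κ j}, ℂ)` of `X`) with a model
map `v : α → Pt'` (forget the copy, read the embedding in the frame) — NOT injective.  Pohlmann's condition for `X`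
reads `#{x ∈ T | g · v(x) ∈ Φ} = #{x ∈ T | g · v(x) ∉ Φ}` for the twelve `g` (`ModelBalanced v T`).

RESULTS.
* `exists_defects_of_modelBalanced` — THE SIGN-DEFECT EQUATIONS: writing `N(y) = #{x ∈ T | v x = y}`, a balanced
  configuration has place-independent defects `N(m,i,+) − N(m,i,−) = dₘ` (`m = 0, 1`, all places `i`) and
  `N(E,+) − N(E,−) = d₀ + d₁` (six of the twelve conditions and the total count, linear algebra by `omega`);
* `exists_part_of_modelBalanced` — a non-empty balanced configuration contains a PART `G` on which `v` is injective with
  `v(G)` a generating weight (`d₀ > 0 < d_E`: a lifted `weil4 0 +`; …; `d₀ > 0 > d₁`: a lifted `pair6 +`; all defects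
  zero: a lifted conjugate pair);
* `ModelBalanced.sdiff`, `modelBalanced_of_image_mem_gens` — removing a balanced part keeps the balance; generating
  parts are balanced (`gens_balanced` of the census file);
* **`modelBalanced_induction`** — INDUCTION PRINCIPLE: a property of configurations that holds for `∅` and passes from
  `R` to `G ∪ R` for every disjoint generating part `G` holds for every balanced configuration.  For ONE copy of each
  factor this re-proves the kernel census `balanced'_decomp` of the companion file; for `B₀^a × B₁^b × E^c` it is the
  combinatorial half of the Hodge conjecture for all powers (geometric half: the distribution lemma
  `CorCM/CMWeightDistribution.lean` + Markman's theorem on the generating lines of `Y`).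
[cite: Pohlmann1968, Thm 1] [cite: GaoUllmo2025, Thm 3.1] [cite: Milne2020HodgeClassesAV, 1.2 (a)]

## References
* [Pohlmann1968] H. Pohlmann, Ann. of Math. 88 (1968), Thm 1.  [GaoUllmo2025] Z. Gao, E. Ullmo, J. Inst. Math. Jussieu
  25 (2025), Thm 3.1.  [Milne2020HodgeClassesAV] J. S. Milne, arXiv:2010.08857, 1.2 (a) and Thm. 1 (André's theorem:
  CM Hodge classes are sums of pull-backs of Weil classes).  [Gordon1999HodgeAVSurvey] B. B. Gordon, §9.2.
-/

namespace Summit.HodgeConjecture.CorCM.Census.DihedralSexticPairCurvePowers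

open Finset
open Summit.HodgeConjecture.CorCM.Census.DihedralSexticPair (Pt act)
open Summit.HodgeConjecture.CorCM.Census.DihedralSexticPairCurve (Pt' act' phi' balanced' conjPair weil4 pair6 gens
  mem_gens_iff mem_conjPair_iff gens_balanced isCMType_phi')

variable {α : Type*}

/-! ### Balanced configurations -/

/-- **Pohlmann's condition for a configuration** `(T, v)` (a weight of a power `⨁_j A₃(κ j)` read in the 14-point model,
`v` = copy-forgetting model map): for each of the twelve `g = (j, f, d) ∈ S₃ × C₂`,
`#{x ∈ T | g·v(x) ∈ Φ} = #{x ∈ T | g·v(x) ∉ Φ}`. [cite: GaoUllmo2025, Thm 3.1 eq. (3.2)] -/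
def ModelBalanced (v : α → Pt') (T : Finset α) : Prop :=
  ∀ (j : ZMod 3) (f d : Bool),
    (T.filter fun x => act' j f d (v x) ∈ phi').card = (T.filter fun x => act' j f d (v x) ∉ phi').card

variable (v : α → Pt')

/-- Unfolding. [cite: GaoUllmo2025, Thm 3.1 eq. (3.2)] -/
theorem modelBalanced_iff (T : Finset α) : ModelBalanced v T ↔ ∀ (j : ZMod 3) (f d : Bool),
    (T.filter fun x => act' j f d (v x) ∈ phi').card = (T.filter fun x => act' j f d (v x) ∉ phi').card :=
  Iff.rfl

/-- Balanced ⟺ twice the `Φ`-count is the size, for every `g`. [cite: GaoUllmo2025, Thm 3.1 eq. (3.2)] -/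
theorem modelBalanced_iff_two_mul (T : Finset α) : ModelBalanced v T ↔ ∀ (j : ZMod 3) (f d : Bool),
    2 * (T.filter fun x => act' j f d (v x) ∈ phi').card = T.card := by
  refine forall_congr' fun j => forall_congr' fun f => forall_congr' fun d => ?_
  have h := Finset.card_filter_add_card_filter_not (s := T) (fun x => act' j f d (v x) ∈ phi')
  omega

/-- The empty configuration is balanced. [folklore] -/
theorem modelBalanced_empty : ModelBalanced v (∅ : Finset α) := fun _ _ _ => by simp

variable {v}

/-- **Removing a balanced part keeps the balance.** [folklore] -/
theorem ModelBalanced.sdiff [DecidableEq α] {T G : Finset α} (hT : ModelBalanced v T) (hG : ModelBalanced v G)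
    (hGT : G ⊆ T) : ModelBalanced v (T \ G) := by
  intro j f d
  have key : ∀ (Q : α → Prop) [DecidablePred Q],
      ((T \ G).filter Q).card = (T.filter Q).card - (G.filter Q).card := by
    intro Q _
    rw [← Finset.card_sdiff_of_subset (Finset.filter_subset_filter Q hGT)]
    congr 1
    ext x
    simp only [Finset.mem_filter, Finset.mem_sdiff]
    tauto
  rw [key, key, hT j f d, hG j f d]

/-- The union of two disjoint balanced configurations is balanced. [folklore] -/
theorem ModelBalanced.union [DecidableEq α] {G R : Finset α} (hG : ModelBalanced v G) (hR : ModelBalanced v R)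
    (hGR : Disjoint G R) : ModelBalanced v (G ∪ R) := by
  intro j f d
  rw [Finset.filter_union, Finset.filter_union,
    Finset.card_union_of_disjoint (Finset.disjoint_filter_filter hGR),
    Finset.card_union_of_disjoint (Finset.disjoint_filter_filter hGR), hG j f d, hR j f d]

/-- Counting through a model map injective on the part: `#{x ∈ G | Q(v x)} = #{y ∈ v(G) | Q y}`. [folklore] -/
theorem card_filter_comp_eq_card_filter_image {G : Finset α} (hinj : Set.InjOn v ↑G) (Q : Pt' → Prop)
    [DecidablePred Q] : (G.filter fun x => Q (v x)).card = ((G.image v).filter Q).card := by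
  rw [Finset.filter_image, Finset.card_image_of_injOn]
  exact fun x hx y hy h => hinj (Finset.mem_of_mem_filter _ hx) (Finset.mem_of_mem_filter _ hy) h

/-- A part on which `v` is injective with balanced model image is balanced. [cite: GaoUllmo2025, Thm 3.1] -/
theorem modelBalanced_of_injOn_of_balanced' {G : Finset α} (hinj : Set.InjOn v ↑G)
    (hbal : balanced' (G.image v) = true) : ModelBalanced v G := by
  intro j f d
  rw [balanced', decide_eq_true_eq] at hbal
  rw [card_filter_comp_eq_card_filter_image hinj (fun y => act' j f d y ∈ phi'),
    card_filter_comp_eq_card_filter_image hinj (fun y => act' j f d y ∉ phi')]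
  exact hbal (j, f, d)

/-- **Generating parts are balanced** (the census file's `gens_balanced`). [cite: Deligne1982HodgeCycles, §5 (c)] -/
theorem modelBalanced_of_image_mem_gens {G : Finset α} (hinj : Set.InjOn v ↑G) (hg : G.image v ∈ gens) :
    ModelBalanced v G := by
  refine modelBalanced_of_injOn_of_balanced' hinj ?_
  rcases (mem_gens_iff _).1 hg with ⟨y, hy⟩ | ⟨m, b, hy⟩ | hy | hy <;> rw [hy]
  · exact gens_balanced.1 y
  · exact (gens_balanced.2.1 m b).1
  · exact (gens_balanced.2.2 true).1
  · exact (gens_balanced.2.2 false).1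

/-! ### Counting fibrewise -/

variable (v)

/-- `#{x ∈ T | Q(v x)} = Σ_{y : Q y} #{x ∈ T | v x = y}`. [folklore] -/
theorem card_filter_comp_eq_sum (T : Finset α) (Q : Pt' → Prop) [DecidablePred Q] :
    (T.filter fun x => Q (v x)).card = ∑ y ∈ univ.filter Q, (T.filter fun x => v x = y).card := by
  rw [Finset.card_eq_sum_card_fiberwise (f := v) (t := univ.filter Q)
    (fun x hx => Finset.mem_filter.2 ⟨Finset.mem_univ _, (Finset.mem_filter.1 hx).2⟩)]
  refine Finset.sum_congr rfl fun y hy => ?_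
  have hQy : Q y := (Finset.mem_filter.1 hy).2
  congr 1
  ext x
  simp only [Finset.mem_filter]
  constructor
  · rintro ⟨⟨hx, -⟩, hxy⟩; exact ⟨hx, hxy⟩
  · rintro ⟨hx, hxy⟩; exact ⟨⟨hx, hxy ▸ hQy⟩, hxy⟩

/-- The same with the in-set enumerated by a duplicate-free list: `#{x ∈ T | Q(v x)} = Σ_{y ∈ l} #{x ∈ T | v x = y}`.
[folklore] -/
theorem card_filter_comp_eq_list_sum (T : Finset α) (Q : Pt' → Prop) [DecidablePred Q] (l : List Pt')
    (hl : l.Nodup) (hQ : univ.filter Q = l.toFinset) :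
    (T.filter fun x => Q (v x)).card = (l.map fun y => (T.filter fun x => v x = y).card).sum := by
  rw [card_filter_comp_eq_sum, hQ, List.sum_toFinset _ hl]

/-- The total count: `|T| = Σ_y #{x ∈ T | v x = y}` over the fourteen model points. [folklore] -/
theorem card_eq_list_sum (T : Finset α) :
    T.card = ([Sum.inl true, Sum.inl false,
      Sum.inr (0, 0, true), Sum.inr (0, 1, true), Sum.inr (0, 2, true),
      Sum.inr (0, 0, false), Sum.inr (0, 1, false), Sum.inr (0, 2, false),
      Sum.inr (1, 0, true), Sum.inr (1, 1, true), Sum.inr (1, 2, true),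
      Sum.inr (1, 0, false), Sum.inr (1, 1, false), Sum.inr (1, 2, false)].map
        fun y : Pt' => (T.filter fun x => v x = y).card).sum := by
  rw [← card_filter_comp_eq_list_sum v T (fun _ => True) _ (by decide) (by decide)]
  simp

/-! ### The sign-defect equations -/

variable {v}

/-- **THE SIGN-DEFECT EQUATIONS of a balanced configuration.**  With `N(y) = #{x ∈ T | v x = y}`: there are integers
`d₀, d₁` with `N(m, i, +) − N(m, i, −) = dₘ` for both threefold types `m` and ALL places `i`, and
`N(E, +) − N(E, −) = d₀ + d₁`.  (From the six conditions `g = (π, +)`, `π ∈ S₃`: the `Φ`-preimage of `(π, +)` is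
`{(E,+)} ⊔ {(m, π⁻¹ m, +)} ⊔ {(m, i, −) : i ≠ π⁻¹ m}`, and the total count.) [cite: GaoUllmo2025, Thm 3.1]
[cite: Pohlmann1968, Thm 1] -/
theorem exists_defects_of_modelBalanced {T : Finset α} (hT : ModelBalanced v T) : ∃ d₀ d₁ : ℤ,
    (∀ i : ZMod 3, ((T.filter fun x => v x = Sum.inr (0, i, true)).card : ℤ) -
      (T.filter fun x => v x = Sum.inr (0, i, false)).card = d₀) ∧
    (∀ i : ZMod 3, ((T.filter fun x => v x = Sum.inr (1, i, true)).card : ℤ) -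
      (T.filter fun x => v x = Sum.inr (1, i, false)).card = d₁) ∧
    ((T.filter fun x => v x = Sum.inl true).card : ℤ) - (T.filter fun x => v x = Sum.inl false).card = d₀ + d₁ := by
  have hb := (modelBalanced_iff_two_mul v T).1 hT
  -- the six conditions `(j, f, +)`; in-sets listed as (E,+), slot-0 `+`-place, slot-0 `−`-places, slot-1 likewise
  have e1 := hb 0 false true
  have e2 := hb 1 false true
  have e3 := hb 2 false true
  have e4 := hb 0 true true
  have e5 := hb 1 true true
  have e6 := hb 2 true true
  rw [card_filter_comp_eq_list_sum v T (fun y => act' 0 false true y ∈ phi')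
    [Sum.inl true, Sum.inr (0, 0, true), Sum.inr (0, 1, false), Sum.inr (0, 2, false),
      Sum.inr (1, 1, true), Sum.inr (1, 0, false), Sum.inr (1, 2, false)] (by decide) (by decide)] at e1
  rw [card_filter_comp_eq_list_sum v T (fun y => act' 1 false true y ∈ phi')
    [Sum.inl true, Sum.inr (0, 2, true), Sum.inr (0, 0, false), Sum.inr (0, 1, false),
      Sum.inr (1, 0, true), Sum.inr (1, 1, false), Sum.inr (1, 2, false)] (by decide) (by decide)] at e2
  rw [card_filter_comp_eq_list_sum v T (fun y => act' 2 false true y ∈ phi')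
    [Sum.inl true, Sum.inr (0, 1, true), Sum.inr (0, 0, false), Sum.inr (0, 2, false),
      Sum.inr (1, 2, true), Sum.inr (1, 0, false), Sum.inr (1, 1, false)] (by decide) (by decide)] at e3
  rw [card_filter_comp_eq_list_sum v T (fun y => act' 0 true true y ∈ phi')
    [Sum.inl true, Sum.inr (0, 0, true), Sum.inr (0, 1, false), Sum.inr (0, 2, false),
      Sum.inr (1, 2, true), Sum.inr (1, 0, false), Sum.inr (1, 1, false)] (by decide) (by decide)] at e4
  rw [card_filter_comp_eq_list_sum v T (fun y => act' 1 true true y ∈ phi')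
    [Sum.inl true, Sum.inr (0, 1, true), Sum.inr (0, 0, false), Sum.inr (0, 2, false),
      Sum.inr (1, 0, true), Sum.inr (1, 1, false), Sum.inr (1, 2, false)] (by decide) (by decide)] at e5
  rw [card_filter_comp_eq_list_sum v T (fun y => act' 2 true true y ∈ phi')
    [Sum.inl true, Sum.inr (0, 2, true), Sum.inr (0, 0, false), Sum.inr (0, 1, false),
      Sum.inr (1, 1, true), Sum.inr (1, 0, false), Sum.inr (1, 2, false)] (by decide) (by decide)] at e6
  have e0 := card_eq_list_sum v T
  simp only [List.map_cons, List.map_nil, List.sum_cons, List.sum_nil] at e0 e1 e2 e3 e4 e5 e6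
  refine ⟨((T.filter fun x => v x = Sum.inr (0, 0, true)).card : ℤ) -
      (T.filter fun x => v x = Sum.inr (0, 0, false)).card,
    ((T.filter fun x => v x = Sum.inr (1, 0, true)).card : ℤ) -
      (T.filter fun x => v x = Sum.inr (1, 0, false)).card, fun i => ?_, fun i => ?_, ?_⟩
  · fin_cases i
    · rfl
    · push_cast; omega
    · push_cast; omega
  · fin_cases i
    · rfl
    · push_cast; omega
    · push_cast; omega
  · omega

/-! ### Extraction of a generating part -/

/-- Membership in `pair6 true = {(0,i,+)} ⊔ {(1,i,−)}` and `pair6 false = {(0,i,−)} ⊔ {(1,i,+)}`, read by sign.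
[cite: Deligne1982HodgeCycles, §5 (c)] -/
theorem mem_pair6_iff' (b : Bool) (y : Pt') :
    y ∈ pair6 b ↔ ∃ i : ZMod 3, y = Sum.inr (0, i, b) ∨ y = Sum.inr (1, i, !b) := by
  revert y b
  decide

/-- A finset of model points all of which are hit by `T` is the injective image of a part of `T`. [folklore] -/
theorem exists_part_of_forall_exists [DecidableEq α] {T : Finset α} (W : Finset Pt')
    (hW : ∀ y ∈ W, ∃ x ∈ T, v x = y) : ∃ G ⊆ T, Set.InjOn v ↑G ∧ G.image v = W := by
  classical
  by_cases hWe : W = ∅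
  · subst hWe
    exact ⟨∅, Finset.empty_subset _, fun x hx => absurd hx (by simp), Finset.image_empty _⟩
  obtain ⟨y₀, hy₀⟩ := Finset.nonempty_iff_ne_empty.2 hWe
  obtain ⟨x₀, -, -⟩ := hW y₀ hy₀
  haveI : Nonempty α := ⟨x₀⟩
  choose! pick hpickT hpickv using hW
  refine ⟨W.image pick, fun x hx => ?_, fun x hx x' hx' hxx' => ?_, ?_⟩
  · obtain ⟨y, hy, rfl⟩ := Finset.mem_image.1 hx
    exact hpickT y hy
  · obtain ⟨y, hy, rfl⟩ := Finset.mem_image.1 (Finset.mem_coe.1 hx)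
    obtain ⟨y', hy', rfl⟩ := Finset.mem_image.1 (Finset.mem_coe.1 hx')
    rw [hpickv y hy, hpickv y' hy'] at hxx'
    rw [hxx']
  · rw [Finset.image_image]
    conv_rhs => rw [← Finset.image_id (s := W)]
    exact Finset.image_congr fun y hy => by simpa using hpickv y (Finset.mem_coe.1 hy)

/-- A model point hit by `T` means a positive fibre count. [folklore] -/
theorem exists_mem_of_card_pos {T : Finset α} {y : Pt'} (h : 0 < (T.filter fun x => v x = y).card) :
    ∃ x ∈ T, v x = y := by
  obtain ⟨x, hx⟩ := Finset.card_pos.1 h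
  exact ⟨x, (Finset.mem_filter.1 hx).1, (Finset.mem_filter.1 hx).2⟩

/-- **EXTRACTION.**  A non-empty balanced configuration contains a part `G` on which the model map is injective and
whose image is a generating weight (`conjPair`, `weil4 m b` or `pair6 b`): by the sign-defect equations, if `d₀ > 0`
and `d_E > 0` every `(0, i, +)` and `(E, +)` is hit (a lifted `weil4 0 true`), …, if `d₀ > 0 > d₁` every `(0, i, +)` and
`(1, i, −)` is hit (a lifted `pair6 true`), and if all defects vanish the conjugate of any hit point is hit (a lifted
conjugate pair). [cite: Milne2020HodgeClassesAV, 1.2 (a) and Thm. 1] [cite: Deligne1982HodgeCycles, §5 (c)] -/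
theorem exists_part_of_modelBalanced [DecidableEq α] {T : Finset α} (hT : ModelBalanced v T) (hne : T.Nonempty) :
    ∃ G ⊆ T, G.Nonempty ∧ Set.InjOn v ↑G ∧ G.image v ∈ gens := by
  obtain ⟨d₀, d₁, h0, h1, hE⟩ := exists_defects_of_modelBalanced hT
  -- an opaque name for the fourteen counts
  obtain ⟨N, hN⟩ : ∃ N : Pt' → ℕ, ∀ y, (T.filter fun x => v x = y).card = N y := ⟨_, fun _ => rfl⟩
  simp only [hN] at h0 h1 hE
  have h0' : ∀ i : ZMod 3, (N (Sum.inr (0, i, true)) : ℤ) - N (Sum.inr (0, i, false)) = d₀ := h0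
  have h1' : ∀ i : ZMod 3, (N (Sum.inr (1, i, true)) : ℤ) - N (Sum.inr (1, i, false)) = d₁ := h1
  have hE' : (N (Sum.inl true) : ℤ) - N (Sum.inl false) = d₀ + d₁ := hE
  clear h0 h1 hE
  have hit : ∀ y, 0 < N y → ∃ x ∈ T, v x = y := fun y hy => exists_mem_of_card_pos (v := v) (by rw [hN]; exact hy)
  -- a generating weight all of whose points are hit gives the part
  have conclude : ∀ W ∈ gens, W.Nonempty → (∀ y ∈ W, 0 < N y) →
      ∃ G ⊆ T, G.Nonempty ∧ Set.InjOn v ↑G ∧ G.image v ∈ gens := by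
    intro W hW hWne hWhit
    obtain ⟨G, hGT, hinj, hGW⟩ := exists_part_of_forall_exists W fun y hy => hit y (hWhit y hy)
    refine ⟨G, hGT, ?_, hinj, hGW ▸ hW⟩
    obtain ⟨y, hy⟩ := hWne
    rw [← hGW] at hy
    obtain ⟨x, hx, -⟩ := Finset.mem_image.1 hy
    exact ⟨x, hx⟩
  have hgens4 : ∀ m b, weil4 m b ∈ gens := fun m b => (mem_gens_iff _).2 (Or.inr (Or.inl ⟨m, b, rfl⟩))
  have hgens6 : ∀ b, pair6 b ∈ gens := fun b => by
    cases b
    · exact (mem_gens_iff _).2 (Or.inr (Or.inr (Or.inr rfl)))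
    · exact (mem_gens_iff _).2 (Or.inr (Or.inr (Or.inl rfl)))
  have hgens2 : ∀ y, conjPair y ∈ gens := fun y => (mem_gens_iff _).2 (Or.inl ⟨y, rfl⟩)
  have hne4 : ∀ m b, (weil4 m b).Nonempty := fun m b => ⟨Sum.inl b, by rw [Census.DihedralSexticPairCurve.mem_weil4_iff]; exact Or.inl rfl⟩
  have hne6 : ∀ b, (pair6 b).Nonempty := fun b =>
    ⟨Sum.inr (0, 0, b), (mem_pair6_iff' b _).2 ⟨0, Or.inl rfl⟩⟩
  have hne2 : ∀ y, (conjPair y).Nonempty := fun y => ⟨y, (mem_conjPair_iff _ _).2 (Or.inl rfl)⟩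
  -- `weil4 m b`: all points hit when `d_m` and `d_E` have the sign of `b`
  have weil4_hit : ∀ (m : Fin 2) (b : Bool),
      (∀ i : ZMod 3, 0 < N (Sum.inr (m, i, b))) → 0 < N (Sum.inl b) → ∀ y ∈ weil4 m b, 0 < N y := by
    intro m b hi hb y hy
    rcases (Census.DihedralSexticPairCurve.mem_weil4_iff m b y).1 hy with rfl | ⟨i, rfl⟩
    · exact hb
    · exact hi i
  have pair6_hit : ∀ b : Bool, (∀ i : ZMod 3, 0 < N (Sum.inr (0, i, b))) →
      (∀ i : ZMod 3, 0 < N (Sum.inr (1, i, !b))) → ∀ y ∈ pair6 b, 0 < N y := by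
    intro b h0b h1b y hy
    obtain ⟨i, rfl | rfl⟩ := (mem_pair6_iff' b y).1 hy
    · exact h0b i
    · exact h1b i
  -- case analysis on the signs of the defects
  by_cases hd₀ : 0 < d₀
  · by_cases hdE : 0 < d₀ + d₁
    · refine conclude _ (hgens4 0 true) (hne4 0 true) (weil4_hit 0 true (fun i => ?_) ?_)
      · have := h0' i; omega
      · omega
    · -- `d₀ > 0`, `d₀ + d₁ ≤ 0` ⟹ `d₁ < 0`: a lifted `pair6 true`
      refine conclude _ (hgens6 true) (hne6 true) (pair6_hit true (fun i => ?_) (fun i => ?_))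
      · have := h0' i; omega
      · have := h1' i; simp only [Bool.not_true]; omega
  by_cases hd₁ : 0 < d₁
  · by_cases hdE : 0 < d₀ + d₁
    · refine conclude _ (hgens4 1 true) (hne4 1 true) (weil4_hit 1 true (fun i => ?_) ?_)
      · have := h1' i; omega
      · omega
    · -- `d₁ > 0`, `d₀ + d₁ ≤ 0` ⟹ `d₀ < 0`: a lifted `pair6 false`
      refine conclude _ (hgens6 false) (hne6 false) (pair6_hit false (fun i => ?_) (fun i => ?_))
      · have := h0' i; omega
      · have := h1' i; simp only [Bool.not_false]; omega
  -- now `d₀ ≤ 0`, `d₁ ≤ 0`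
  by_cases hd₀' : d₀ < 0
  · by_cases hd₁' : d₁ < 0
    · refine conclude _ (hgens4 0 false) (hne4 0 false) (weil4_hit 0 false (fun i => ?_) ?_)
      · have := h0' i; omega
      · omega
    · -- `d₀ < 0`, `d₁ = 0`: still `d_E < 0`, a lifted `weil4 0 false`
      refine conclude _ (hgens4 0 false) (hne4 0 false) (weil4_hit 0 false (fun i => ?_) ?_)
      · have := h0' i; omega
      · omega
  by_cases hd₁' : d₁ < 0
  · refine conclude _ (hgens4 1 false) (hne4 1 false) (weil4_hit 1 false (fun i => ?_) ?_)
    · have := h1' i; omega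
    · omega
  -- all defects vanish: the conjugate of a hit point is hit
  have hd₀0 : d₀ = 0 := by omega
  have hd₁0 : d₁ = 0 := by omega
  obtain ⟨x, hx⟩ := hne
  have hNx : 0 < N (v x) := by
    rw [← hN]
    exact Finset.card_pos.2 ⟨x, Finset.mem_filter.2 ⟨hx, rfl⟩⟩
  refine conclude _ (hgens2 (v x)) (hne2 (v x)) fun y hy => ?_
  rcases (mem_conjPair_iff _ _).1 hy with rfl | rfl
  · exact hNx
  · -- the conjugate point `c · v x`
    revert hNx
    rcases v x with b | ⟨m, i, b⟩
    · cases b <;>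
        simp only [Census.DihedralSexticPairCurve.act'_inl, Bool.not_true, Bool.not_false, Bool.false_eq_true,
          if_false] <;> intro hNx <;> omega
    · have hc : act' 0 false false (Sum.inr (m, i, b)) = Sum.inr (m, i, !b) := by
        rw [Census.DihedralSexticPairCurve.act'_inr, Census.DihedralSexticPair.act_apply]
        simp
      rw [hc]
      intro hNx
      have hm : m = 0 ∨ m = 1 := by
        rcases m with ⟨_ | _ | k, hk⟩
        · exact Or.inl rfl
        · exact Or.inr rfl
        · omega
      rcases hm with rfl | rfl <;> cases b <;> simp only [Bool.not_true, Bool.not_false] at hNx ⊢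
      · have := h0' i; omega
      · have := h0' i; omega
      · have := h1' i; omega
      · have := h1' i; omega

/-! ### The induction principle -/

/-- **INDUCTION PRINCIPLE FOR BALANCED CONFIGURATIONS (any number of copies).**  Let `motive` hold for the empty
configuration and pass from `R` to `G ∪ R` whenever `G` is disjoint from `R`, the model map is injective on `G` and
`v(G)` is a generating weight of the 14-point model.  Then `motive` holds for every balanced configuration: by
extraction, a non-empty balanced `T` is `G ⊔ (T ∖ G)` with `G` a generating part, and `T ∖ G` is balanced and smaller.
[cite: Milne2020HodgeClassesAV, 1.2 (a) and Thm. 1] [cite: GaoUllmo2025, Thm 3.1] -/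
theorem modelBalanced_induction [DecidableEq α] {motive : Finset α → Prop} (h0 : motive ∅)
    (hstep : ∀ G R : Finset α, Disjoint G R → Set.InjOn v ↑G → G.image v ∈ gens → motive R → motive (G ∪ R))
    {T : Finset α} (hT : ModelBalanced v T) : motive T := by
  induction T using Finset.strongInduction with
  | H T ih =>
    by_cases hTe : T = ∅
    · subst hTe; exact h0
    obtain ⟨G, hGT, hGne, hinj, hG⟩ := exists_part_of_modelBalanced hT (Finset.nonempty_iff_ne_empty.2 hTe)
    have hR : ModelBalanced v (T \ G) := hT.sdiff (modelBalanced_of_image_mem_gens hinj hG) hGT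
    have hlt : T \ G ⊂ T := Finset.sdiff_ssubset hGT hGne
    have h := hstep G (T \ G) Finset.disjoint_sdiff hinj hG (ih _ hlt hR)
    rwa [Finset.union_sdiff_of_subset hGT] at h

end Summit.HodgeConjecture.CorCM.Census.DihedralSexticPairCurvePowers
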